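import Summits.BirchSwinnertonDyer.BirchSwinnertonDyer.Theorems.ManinLocalTwoThreeShimuraLedgerIrreducible
import Literature.NumberTheory.EllipticCurves.LatticeInclusionIsogenyDegreeProofs
import Literature.NumberTheory.EllipticCurves.IsogenyDegreeOneProofs
import HarnessLib

/-!
# Stevens' `X₁(N)`-optimal curve IS the strong Weil curve when the Shimura cover is trivial:
# `p² ∣ N` and `W₀[p]` irreducible (e.g. `4 ∣ N` without rational `2`-torsion) ⟹ `W₁ ≅ W₀` by `u = ±1`

Summit `BirchSwinnertonDyer`, route `ManinLocalTwoThree` (cell bsd-f2-manin), crux C2 `ManinOddAtFour` (stmt-BirchSwinnertonDyer-22967;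
also C3 stmt-…-22968).  Prover seat bsd-line-manin23-p1 (C2/C3 LEAD), gen 9; sequel to `ManinLocalTwoThreeShimuraLedgerIrreducible.lean`
(`Λ₁(f) = Λ₀(f)` and `|c₀| = |c₁|` on the irreducible locus at a traceless level).

For ISOGENOUS globally minimal elliptic `W₁ ~ W₀` over `ℚ`, an OPTIMAL `X₁(N)`-datum `D₁` of `W₁` (`Λ_{W₁} = c₁Λ₁(f)`) and a
lattice-optimal `X₀(N)`-datum `D₀` of `W₀` (`Λ_{W₀} = c₀Λ₀(f)`):

* `neronLattice_eq_of_sq_dvd_of_hasIrreducibleModPGaloisRep` — if `p² ∣ N` and `W₀[p]` is irreducible then the two Néron lattices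
  COINCIDE: `D₁.L.lattice = D₀.L.lattice` (same newform; `Λ₁(f) = Λ₀(f)`; `c₀ = ±c₁`).
* **`exists_variableChange_eq_of_sq_dvd_of_hasIrreducibleModPGaloisRep`** — hence a `ℚ`-isogeny `W₁ → W₀` of degree `1`
  (`exists_isogeny_degree_eq_of_isNeronLatticeOf`: degree = lattice index) and `W₀ = C • W₁` for a change of variables `C` over `ℚ`
  (`exists_variableChange_eq_of_degree_eq_one`) with `C.u = ±1` and `r, s, t ∈ ℤ` (`isGloballyMinimal_unique_holds`): STEVENS'
  `X₁(N)`-OPTIMAL CURVE IS THE STRONG WEIL CURVE of the class.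
* `…_of_four_dvd_of_noRationalTwoTorsion` (`4 ∣ N`, no rational root of the `2`-division cubic) and
  `…_of_nine_dvd_of_forall_not_isRoot_Ψ₃` (`9 ∣ N`, no rational root of `Ψ₃`).

HONEST FRAMING: unconditional tree theorems (standard axioms); they identify the two optimal curves but decide no Manin constant's value
(Stevens' `c₁ = 1` and Manin's `c₀ = 1` become the SAME statement there).  No crux stub is narrowed; C2, C3, Manin's conjecture and
BSD are NOT proved by this file.  No definitions, no sorry.

References: G. Stevens, Invent. Math. 98 (1989) §2 [Stevens1989]; S. Ling, J. Oesterlé, Astérisque 196–197 (1991) Thm. 6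
[LingOesterle1991]; K. Ribet [Ribet1988Shimura]; J. H. Silverman, *AEC* VI.4.1, III.3.1 [SilvermanAEC2009].
-/

set_option autoImplicit false
set_option linter.dupNamespace false

noncomputable section

open scoped Classical MatrixGroups ModularForm

open CongruenceSubgroup Complex WeierstrassCurve Literature.NumberTheory.EllipticCurves
  Literature.NumberTheory.EllipticCurves.ModularForms

namespace Summit.BirchSwinnertonDyer.BirchSwinnertonDyer.Theorems.ManinLocalTwoThree

variable {W₁ W₀ : WeierstrassCurve ℚ} [W₁.IsElliptic] [W₁.IsGloballyMinimal] [W₀.IsElliptic]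
  [W₀.IsGloballyMinimal] {N : ℕ} [NeZero N]

/-- **Trivial Shimura cover ⟹ equal Néron lattices.**  `p² ∣ N`, `W₀[p]` irreducible, `W₁ ~ W₀`, `D₁` optimal `X₁(N)`-datum,
`D₀` lattice-optimal `X₀(N)`-datum ⟹ `Λ_{W₁} = Λ_{W₀}` (as subsets of `ℂ`): same newform `f`
(`Gamma1ParametrizationData.f_eq_of_isIsogenous`), `Λ₁(f) = Λ₀(f)` (`periodLatticeGamma1_eq_periodLattice_of_sq_dvd_of_hasIrreducibleModPGaloisRep`),
`|c₀| = |c₁|` (`natAbs_maninConstant₀_eq_natAbs_maninConstant₁_of_sq_dvd_of_hasIrreducibleModPGaloisRep`), and lattices are symmetric.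
[cite: LingOesterle1991, Thm. 6] [cite: Ribet1988Shimura, Thm. 1 and §3] -/
theorem neronLattice_eq_of_sq_dvd_of_hasIrreducibleModPGaloisRep
    (D₁ : Gamma1ParametrizationData W₁ N) (D₀ : ModularParametrizationData W₀ N) (hiso : IsIsogenous W₁ W₀)
    (h₁ : D₁.IsOptimal) (h₀ : ∀ z ∈ D₀.L.lattice, ∃ w ∈ periodLattice D₀.f, z = D₀.c * w)
    {p : ℕ} (hp : p.Prime) (hpN : p ^ 2 ∣ N) (hirr : W₀.HasIrreducibleModPGaloisRep p) :
    (D₁.L.lattice : Set ℂ) = D₀.L.lattice := by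
  have hf : D₁.f = D₀.f := D₁.f_eq_of_isIsogenous D₀ hiso
  have hΛ : periodLatticeGamma1 D₀.f = periodLattice D₀.f :=
    periodLatticeGamma1_eq_periodLattice_of_sq_dvd_of_hasIrreducibleModPGaloisRep W₀ D₀.isNewformOf hp hpN hirr
  have hc : D₀.maninConstant.natAbs = D₁.maninConstant.natAbs :=
    natAbs_maninConstant₀_eq_natAbs_maninConstant₁_of_sq_dvd_of_hasIrreducibleModPGaloisRep D₁ D₀ hiso h₁ h₀ hp hpN hirr
  have hc' : D₀.c = D₁.c ∨ D₀.c = -D₁.c := Int.natAbs_eq_natAbs_iff.mp hc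
  -- `c₀ w` and `c₁ w` differ by a sign
  have hsign : ∀ w : ℂ, (D₀.c : ℂ) * w = (D₁.c : ℂ) * w ∨ (D₀.c : ℂ) * w = -((D₁.c : ℂ) * w) := by
    intro w
    rcases hc' with h | h
    · left; rw [h]
    · right; rw [h]; push_cast; ring
  ext z
  constructor
  · intro hz
    obtain ⟨w, hw, rfl⟩ := h₁ z hz
    have hw₀ : w ∈ periodLattice D₀.f := by rw [← hΛ, ← hf]; exact hw
    have hmem : (D₀.c : ℂ) * w ∈ D₀.L.lattice := D₀.smul_periodLattice_le w hw₀
    rcases hsign w with h | h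
    · rw [← h]; exact hmem
    · have : (D₁.c : ℂ) * w = -((D₀.c : ℂ) * w) := by rw [h, neg_neg]
      rw [this]; exact neg_mem hmem
  · intro hz
    obtain ⟨w, hw, rfl⟩ := h₀ z hz
    have hw₁ : w ∈ periodLatticeGamma1 D₁.f := by rw [hf, hΛ]; exact hw
    have hmem : (D₁.c : ℂ) * w ∈ D₁.L.lattice := D₁.smul_periodLatticeGamma1_le w hw₁
    rcases hsign w with h | h
    · rw [h]; exact hmem
    · rw [h]; exact neg_mem hmem

/-- **Stevens' `X₁(N)`-optimal curve is the strong Weil curve when the Shimura cover is trivial.**  `p² ∣ N`, `W₀[p]` irreducible,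
`W₁ ~ W₀` globally minimal, `D₁` optimal `X₁(N)`-datum of `W₁`, `D₀` lattice-optimal `X₀(N)`-datum of `W₀` ⟹ `W₀ = C • W₁` for a change
of variables `C` over `ℚ` with `C.u = ±1` and `r, s, t ∈ ℤ`.  (Equal Néron lattices; the analytic isogeny `z ↦ z` descends to a
`ℚ`-isogeny of degree `[Λ₀ : Λ₁] = 1` by `exists_isogeny_degree_eq_of_isNeronLatticeOf`; degree one ⟹ change of variables
`exists_variableChange_eq_of_degree_eq_one`; both models globally minimal ⟹ `u = ±1`, `isGloballyMinimal_unique_holds`.)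
[cite: Stevens1989, §2 (the X₁(N)-optimal curve; shape)] [cite: SilvermanAEC2009, Thm. VI.4.1(b), Prop. III.3.1(b), VII.1.3(b)] -/
theorem exists_variableChange_eq_of_sq_dvd_of_hasIrreducibleModPGaloisRep
    (D₁ : Gamma1ParametrizationData W₁ N) (D₀ : ModularParametrizationData W₀ N) (hiso : IsIsogenous W₁ W₀)
    (h₁ : D₁.IsOptimal) (h₀ : ∀ z ∈ D₀.L.lattice, ∃ w ∈ periodLattice D₀.f, z = D₀.c * w)
    {p : ℕ} (hp : p.Prime) (hpN : p ^ 2 ∣ N) (hirr : W₀.HasIrreducibleModPGaloisRep p) :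
    ∃ C : VariableChange ℚ, C • W₁ = W₀ ∧ (C.u = 1 ∨ C.u = -1) ∧ ∃ r s t : ℤ, C.r = r ∧ C.s = s ∧ C.t = t := by
  have hΛ := neronLattice_eq_of_sq_dvd_of_hasIrreducibleModPGaloisRep D₁ D₀ hiso h₁ h₀ hp hpN hirr
  have hle : ∀ z ∈ D₁.L.lattice, ((1 : ℚ) : ℂ) * z ∈ D₀.L.lattice := by
    intro z hz
    rw [Rat.cast_one, one_mul]
    have : z ∈ (D₁.L.lattice : Set ℂ) := hz
    rw [hΛ] at this
    exact this
  obtain ⟨φ, hdeg⟩ := exists_isogeny_degree_eq_of_isNeronLatticeOf W₁ W₀ D₁.isNeronLattice D₀.isNeronLattice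
    one_ne_zero hle
  have hdeg1 : φ.degree = 1 := by
    rw [hdeg, AddSubgroup.relIndex_eq_one]
    intro z hz
    rw [AddSubgroup.mem_comap] at hz
    change (1 : ℚ) * z ∈ D₀.L.lattice.toAddSubgroup at hz
    have hz' : z ∈ (D₀.L.lattice : Set ℂ) := by
      have : ((1 : ℚ) : ℂ) * z = z := by rw [Rat.cast_one, one_mul]
      rw [this] at hz
      exact hz
    rw [← hΛ] at hz'
    exact hz'
  obtain ⟨C, hC⟩ := φ.exists_variableChange_eq_of_degree_eq_one hdeg1
  haveI : (C • W₁).IsGloballyMinimal := by rw [hC]; infer_instance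
  obtain ⟨hu, r, s, t, hr, hs, ht⟩ := isGloballyMinimal_unique_holds W₁ C
  exact ⟨C, hC, hu, r, s, t, hr, hs, ht⟩

/-- **At `4 ∣ N` without rational `2`-torsion, Stevens' curve is the strong Weil curve** (`W₀ = C • W₁`, `u = ±1`, integral `r,s,t`).
[cite: Stevens1989, §2 (shape)] [cite: LingOesterle1991, Thm. 6] -/
theorem exists_variableChange_eq_of_four_dvd_of_noRationalTwoTorsion
    (D₁ : Gamma1ParametrizationData W₁ N) (D₀ : ModularParametrizationData W₀ N) (hiso : IsIsogenous W₁ W₀)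
    (h₁ : D₁.IsOptimal) (h₀ : ∀ z ∈ D₀.L.lattice, ∃ w ∈ periodLattice D₀.f, z = D₀.c * w) (h4 : 2 ^ 2 ∣ N)
    (hT : ∀ e : ℚ, ¬ W₀.twoTorsionPolynomial.toPoly.IsRoot e) :
    ∃ C : VariableChange ℚ, C • W₁ = W₀ ∧ (C.u = 1 ∨ C.u = -1) ∧ ∃ r s t : ℤ, C.r = r ∧ C.s = s ∧ C.t = t := by
  refine exists_variableChange_eq_of_sq_dvd_of_hasIrreducibleModPGaloisRep D₁ D₀ hiso h₁ h₀ Nat.prime_two h4 ?_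
  by_contra hred
  obtain ⟨e, he⟩ := (W₀.not_hasIrreducibleModPGaloisRep_two_iff_exists_isRoot_twoTorsionPolynomial).mp hred
  exact hT e he

/-- **At `9 ∣ N` without a rational root of `Ψ₃`, Stevens' curve is the strong Weil curve.**
[cite: Stevens1989, §2 (shape)] [cite: LingOesterle1991, Thm. 6] -/
theorem exists_variableChange_eq_of_nine_dvd_of_forall_not_isRoot_Ψ₃
    (D₁ : Gamma1ParametrizationData W₁ N) (D₀ : ModularParametrizationData W₀ N) (hiso : IsIsogenous W₁ W₀)
    (h₁ : D₁.IsOptimal) (h₀ : ∀ z ∈ D₀.L.lattice, ∃ w ∈ periodLattice D₀.f, z = D₀.c * w) (h9 : 3 ^ 2 ∣ N)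
    (hΨ : ∀ x₀ : ℚ, ¬ W₀.Ψ₃.IsRoot x₀) :
    ∃ C : VariableChange ℚ, C • W₁ = W₀ ∧ (C.u = 1 ∨ C.u = -1) ∧ ∃ r s t : ℤ, C.r = r ∧ C.s = s ∧ C.t = t :=
  exists_variableChange_eq_of_sq_dvd_of_hasIrreducibleModPGaloisRep D₁ D₀ hiso h₁ h₀ Nat.prime_three h9
    ((W₀.hasIrreducibleModPGaloisRep_three_iff_forall_not_isRoot_Ψ₃).mpr hΨ)

/-! ### Appendix (same session): the general form — ANY trivial Shimura cover — and the two-traceless-primes instance -/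

/-- **Equal Néron lattices whenever `Λ₁(f) = Λ₀(f)`** (general form of `neronLattice_eq_of_sq_dvd_of_hasIrreducibleModPGaloisRep`):
`W₁ ~ W₀` globally minimal, `D₁` optimal `X₁(N)`-datum, `D₀` lattice-optimal `X₀(N)`-datum, `Λ₁(D₀.f) = Λ₀(D₀.f)` ⟹ `Λ_{W₁} = Λ_{W₀}`
(`|c₀| = |c₁|` by the tree's `natAbs_maninConstant₀_eq_of_periodLatticeGamma1_eq_periodLattice`). [cite: LingOesterle1991, Thm. 6] [cite: Stevens1989, §2 (shape)] -/
theorem neronLattice_eq_of_periodLatticeGamma1_eq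
    (D₁ : Gamma1ParametrizationData W₁ N) (D₀ : ModularParametrizationData W₀ N) (hiso : IsIsogenous W₁ W₀)
    (h₁ : D₁.IsOptimal) (h₀ : ∀ z ∈ D₀.L.lattice, ∃ w ∈ periodLattice D₀.f, z = D₀.c * w)
    (hΛ : periodLatticeGamma1 D₀.f = periodLattice D₀.f) :
    (D₁.L.lattice : Set ℂ) = D₀.L.lattice := by
  have hf : D₁.f = D₀.f := D₁.f_eq_of_isIsogenous D₀ hiso
  have hc : D₀.maninConstant.natAbs = D₁.maninConstant.natAbs :=
    natAbs_maninConstant₀_eq_of_periodLatticeGamma1_eq_periodLattice D₁ D₀ h₁ h₀ hf hΛ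
  have hc' : D₀.c = D₁.c ∨ D₀.c = -D₁.c := Int.natAbs_eq_natAbs_iff.mp hc
  have hsign : ∀ w : ℂ, (D₀.c : ℂ) * w = (D₁.c : ℂ) * w ∨ (D₀.c : ℂ) * w = -((D₁.c : ℂ) * w) := by
    intro w
    rcases hc' with h | h
    · left; rw [h]
    · right; rw [h]; push_cast; ring
  ext z
  constructor
  · intro hz
    obtain ⟨w, hw, rfl⟩ := h₁ z hz
    have hw₀ : w ∈ periodLattice D₀.f := by rw [← hΛ, ← hf]; exact hw
    have hmem : (D₀.c : ℂ) * w ∈ D₀.L.lattice := D₀.smul_periodLattice_le w hw₀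
    rcases hsign w with h | h
    · rw [← h]; exact hmem
    · have : (D₁.c : ℂ) * w = -((D₀.c : ℂ) * w) := by rw [h, neg_neg]
      rw [this]; exact neg_mem hmem
  · intro hz
    obtain ⟨w, hw, rfl⟩ := h₀ z hz
    have hw₁ : w ∈ periodLatticeGamma1 D₁.f := by rw [hf, hΛ]; exact hw
    have hmem : (D₁.c : ℂ) * w ∈ D₁.L.lattice := D₁.smul_periodLatticeGamma1_le w hw₁
    rcases hsign w with h | h
    · rw [h]; exact hmem
    · rw [h]; exact neg_mem hmem

/-- **Trivial Shimura cover ⟹ Stevens' curve is the strong Weil curve** (general form): `Λ₁(f) = Λ₀(f)` ⟹ `W₀ = C • W₁` with `C.u = ±1`,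
`r, s, t ∈ ℤ`. [cite: Stevens1989, §2 (shape)] [cite: SilvermanAEC2009, Thm. VI.4.1(b), Prop. III.3.1(b), VII.1.3(b)] -/
theorem exists_variableChange_eq_of_periodLatticeGamma1_eq
    (D₁ : Gamma1ParametrizationData W₁ N) (D₀ : ModularParametrizationData W₀ N) (hiso : IsIsogenous W₁ W₀)
    (h₁ : D₁.IsOptimal) (h₀ : ∀ z ∈ D₀.L.lattice, ∃ w ∈ periodLattice D₀.f, z = D₀.c * w)
    (hΛeq : periodLatticeGamma1 D₀.f = periodLattice D₀.f) :
    ∃ C : VariableChange ℚ, C • W₁ = W₀ ∧ (C.u = 1 ∨ C.u = -1) ∧ ∃ r s t : ℤ, C.r = r ∧ C.s = s ∧ C.t = t := by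
  have hΛ := neronLattice_eq_of_periodLatticeGamma1_eq D₁ D₀ hiso h₁ h₀ hΛeq
  have hle : ∀ z ∈ D₁.L.lattice, ((1 : ℚ) : ℂ) * z ∈ D₀.L.lattice := by
    intro z hz
    rw [Rat.cast_one, one_mul]
    have : z ∈ (D₁.L.lattice : Set ℂ) := hz
    rw [hΛ] at this
    exact this
  obtain ⟨φ, hdeg⟩ := exists_isogeny_degree_eq_of_isNeronLatticeOf W₁ W₀ D₁.isNeronLattice D₀.isNeronLattice
    one_ne_zero hle
  have hdeg1 : φ.degree = 1 := by
    rw [hdeg, AddSubgroup.relIndex_eq_one]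
    intro z hz
    rw [AddSubgroup.mem_comap] at hz
    change (1 : ℚ) * z ∈ D₀.L.lattice.toAddSubgroup at hz
    have hz' : z ∈ (D₀.L.lattice : Set ℂ) := by
      have : ((1 : ℚ) : ℂ) * z = z := by rw [Rat.cast_one, one_mul]
      rw [this] at hz
      exact hz
    rw [← hΛ] at hz'
    exact hz'
  obtain ⟨C, hC⟩ := φ.exists_variableChange_eq_of_degree_eq_one hdeg1
  haveI : (C • W₁).IsGloballyMinimal := by rw [hC]; infer_instance
  obtain ⟨hu, r, s, t, hr, hs, ht⟩ := isGloballyMinimal_unique_holds W₁ C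
  exact ⟨C, hC, hu, r, s, t, hr, hs, ht⟩

/-- **Two additive (traceless) primes ⟹ Stevens' curve is the strong Weil curve** (every curve, e.g. `36 ∣ N`): primes `p ≠ q` with
`p² ∣ N`, `q² ∣ N` (`a_p(f) = a_q(f) = 0`, Atkin–Lehner) give `Λ₁(f) = Λ₀(f)` by the tree's E-imc-21
`gamma1LatticeEqOfTwoTracelessPrimes_holds` (Ling–Oesterlé Thm. 6), hence `W₀ = C • W₁`, `u = ±1` — the isomorphism form of the
tree's E-imc-23 `stevensOptimalIsManinOptimalOfTwoAdditivePrimes_holds`. [cite: LingOesterle1991, Thm. 6] [cite: AtkinLehner1970, Thm. 3] -/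
theorem exists_variableChange_eq_of_two_sq_dvd_level
    (D₁ : Gamma1ParametrizationData W₁ N) (D₀ : ModularParametrizationData W₀ N) (hiso : IsIsogenous W₁ W₀)
    (h₁ : D₁.IsOptimal) (h₀ : ∀ z ∈ D₀.L.lattice, ∃ w ∈ periodLattice D₀.f, z = D₀.c * w)
    {p q : ℕ} (hp : p.Prime) (hq : q.Prime) (hpq : p ≠ q) (hpN : p ^ 2 ∣ N) (hqN : q ^ 2 ∣ N) :
    ∃ C : VariableChange ℚ, C • W₁ = W₀ ∧ (C.u = 1 ∨ C.u = -1) ∧ ∃ r s t : ℤ, C.r = r ∧ C.s = s ∧ C.t = t :=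
  exists_variableChange_eq_of_periodLatticeGamma1_eq D₁ D₀ hiso h₁ h₀
    (gamma1LatticeEqOfTwoTracelessPrimes_holds N D₀.f D₀.isNewformOf.1 p q hp hq hpq
      ((dvd_pow_self p two_ne_zero).trans hpN) ((dvd_pow_self q two_ne_zero).trans hqN)
      (D₀.isNewformOf.1.cuspCoeff_eq_zero_of_sq_dvd hp hpN) (D₀.isNewformOf.1.cuspCoeff_eq_zero_of_sq_dvd hq hqN))

end Summit.BirchSwinnertonDyer.BirchSwinnertonDyer.Theorems.ManinLocalTwoThree

end
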